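import Mathlib
import Literature.Analysis.FluidPDE.Tao2016AveragedNS.ShiftSetCascadeFlows
import Summits.NavierStokesRegularity.NavierStokesRegularity.Theorems.TaoLadderRungTwoFlatCertificateGlueMeshOn
import Summits.NavierStokesRegularity.NavierStokesRegularity.Theorems.TaoLadderRungTwoFlatCertificateGlueBranchOn
import HarnessLib

/-!
# Certificate glue on a shift set `𝕊`, XXII: BRANCH CLAUSES FROM PER-BRANCH MESH CERTIFICATES — the dynamic
  clauses `henc` / `hbefore` / `hafter` / `hread` of the branch layer (glue X-c, consumed by
  `stub_rung_quarter_of_branchChecks`, glue XII-b) from a chain of one-step certificates `StepCert` per branch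
  (helper for item stmt-NavierStokesRegularity-22987 `FlatGapCertificatesV2`, crux K_A♭ of route TaoLadderRungTwoFlat,
  and for stmt-24295 K_A₂(64); cell harvest/h2-tao-ladder, p1 g15; closes referee finding A-66 (α))

The branch consumer (glue X-c / XII-b) takes, per start box `Box b`, statements about EVERY window run from that
box: rough enclosures up to the clock (`henc`), the sign of a section functional at two times `tlo b < thi b`
(`hbefore`, `hafter`) and the static readout at every state reached on the section in between (`hread`). The step
producers of the kernel path (glue XIV/XIV-b exact flow + Grönwall, XVIII/XIX Lohner, XX tree-verifier `Claim`) all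
deliver ONE-STEP certificates `StepCert j` on a time mesh. This module is the missing link (referee c57, A-66 (α)):
for ONE branch — a start box `Box ⊆ Node 0` and a mesh `0 = t 0 < t 1 < … < t N` with every step certified —

* `exists_hull_of_mesh` — every state of a run of length `0 < s ≤ t N` lies in some step hull `Hull j`, `j < N`;
* `henc_of_mesh` — the rough-enclosure clause `henc` of `htrap_of_branches` with `Hull b := ⋃_{j<N} Hull j`;
* `sec_lt_of_mesh` / `le_sec_of_mesh` — the clauses `hbefore` / `hafter` at the mesh times `t j₁` / `t j₂'` from the
  node predicates (`sec < lev` on `Node j₁`, `lev ≤ sec` on `Node j₂'`);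
* `read_of_mesh` — the clause `hread` on `[t j₁, t (j₂+1)]` from a static property of the hulls `Hull j`,
  `j₁ ≤ j ≤ j₂`;

and for a FAMILY of branches (boxes `Box b` covering the fattened core, one mesh per branch) the two clauses of
glue IV verbatim: `htrap_of_branchMeshes`, `hland_of_branchMeshes` (via glue X-c). Pure mesh induction (glue X
`node_of_mesh` / `hull_of_mesh`); no analysis beyond glue X.

HONEST FRAMING: Tao-type MODEL lattices (Tao 2016 §4/§6 vocabulary, shift-set parametrised); the meshes and step
certificates are HYPOTHESES — nothing is computed or certified here, no stub is closed, and nothing here is a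
statement about the Navier–Stokes equations.
-/

noncomputable section

-- the sub-problem namespace repeats the summit name by design (D-0017)
set_option linter.dupNamespace false

namespace Summit.NavierStokesRegularity.NavierStokesRegularity.Theorems

open Set Filter Topology Literature.Analysis.FluidPDE Literature.Analysis.FluidPDE.TaoCascade

namespace CertificateGlueOn

variable {m : ℕ} {𝕊 : Finset (ℤ × ℤ × ℤ)} {ε₀ : ℝ} {α : Fin m → Fin m → Fin m → ℤ × ℤ × ℤ → ℝ} {Kb Ka : ℤ}
  {Eb Et : ℝ} {M : ℤ → ℝ}

/-! ### One branch: a start box and a mesh of certified steps -/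

section OneBranch

variable {t : ℕ → ℝ} {Node Hull : ℕ → (Fin m → ℤ → ℝ) → Prop} {N : ℕ} {Box : (Fin m → ℤ → ℝ) → Prop}

/-- **Every state of a run lies in some step hull**: mesh `0 = t 0 < … < t N`, steps certified, run of length
`0 < s ≤ t N` from `Node 0` in the closed `M`-box ⇒ at every `u ∈ [0,s]` the state lies in `Hull j` for some `j < N`
(the step containing `u`; at a reached node `u = t j = s` the previous step). [cite: Tao2016AveragedNS, §6.3–6.4 Props. 6.4–6.5 (statement shape of a renormalisation certificate); cell certificate format, mesh layer] -/
theorem exists_hull_of_mesh (ht0 : t 0 = 0) (hmono : ∀ j, j < N → t j < t (j + 1))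
    (hstep : ∀ j, j < N → StepCert 𝕊 ε₀ α Kb Ka Eb Et M t Node Hull j)
    {s : ℝ} {S : Fin m → ℤ → ℝ → ℝ} (hrun : WindowRun 𝕊 ε₀ α Kb Ka Eb Et s S) (h0 : Node 0 (slice S 0))
    (hM : ∀ i k, -Kb ≤ k → k ≤ Ka → ∀ u ∈ Icc 0 s, |S i k u| ≤ M k) (hs : 0 < s) (hsN : s ≤ t N)
    {u : ℝ} (hu : u ∈ Icc 0 s) : ∃ j, j < N ∧ Hull j (slice S u) := by
  -- the first mesh index `j` with `u ≤ t (j+1)`; it is `< N` since `u ≤ s ≤ t N`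
  have hN : 0 < N := by
    rcases Nat.eq_zero_or_pos N with h | h
    · subst h; rw [ht0] at hsN; linarith
    · exact h
  have hex : ∃ j, u ≤ t (j + 1) := ⟨N - 1, by rw [Nat.sub_add_cancel hN]; linarith [hu.2]⟩
  classical
  set j := Nat.find hex with hj
  have hju : u ≤ t (j + 1) := Nat.find_spec hex
  have hjN : j < N := by
    by_contra h
    have : N - 1 < j := by omega
    exact (Nat.find_min hex this) (by rw [Nat.sub_add_cancel hN]; linarith [hu.2])
  have htj : t j ≤ u := by
    rcases Nat.eq_zero_or_pos j with h | h
    · rw [h, ht0]; exact hu.1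
    · have := Nat.find_min hex (show j - 1 < j by omega)
      rw [Nat.sub_add_cancel h] at this
      push Not at this
      exact this.le
  by_cases hlt : t j < s
  · exact ⟨j, hjN, hull_of_mesh ht0 hmono hstep hrun h0 hM hjN hlt htj hju hu.2⟩
  · -- `t j = u = s`: the time is the end node of step `j - 1`
    push Not at hlt
    have hjs : t j = s := le_antisymm (htj.trans hu.2) hlt
    have hj1 : 0 < j := by
      rcases Nat.eq_zero_or_pos j with h | h
      · rw [h, ht0] at hjs; linarith
      · exact h
    have hj' : j - 1 < N := by omega
    have hprev : t (j - 1) < s := by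
      have := hmono (j - 1) hj'; rw [Nat.sub_add_cancel hj1] at this; linarith
    have hus : u = s := le_antisymm hu.2 (hjs ▸ htj)
    have hu2 : u ≤ t (j - 1 + 1) := by rw [Nat.sub_add_cancel hj1]; linarith
    exact ⟨j - 1, hj', hull_of_mesh ht0 hmono hstep hrun h0 hM hj' hprev
      (by rw [hus]; exact hprev.le) hu2 hu.2⟩

/-- **THE ROUGH-ENCLOSURE CLAUSE `henc` OF ONE BRANCH FROM ITS MESH**: start box `Box ⊆ Node 0`, mesh up to
`c ≤ t N`, steps certified ⇒ every window run of length `0 < s ≤ c` from `Box` (a priori in the closed `M`-box) lies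
at all times in the branch hull `⋃_{j<N} Hull j` — the hypothesis `henc` of `htrap_of_branches` for this branch.
[cite: Tao2016AveragedNS, §6.3–6.4 Props. 6.4–6.5 (statement shape of a renormalisation certificate); cell certificate format, branch layer from mesh layer] -/
theorem henc_of_mesh {c : ℝ} (ht0 : t 0 = 0) (hmono : ∀ j, j < N → t j < t (j + 1)) (hc : c ≤ t N)
    (hbox : ∀ y, Box y → Node 0 y) (hstep : ∀ j, j < N → StepCert 𝕊 ε₀ α Kb Ka Eb Et M t Node Hull j) :
    ∀ (s : ℝ) (S : Fin m → ℤ → ℝ → ℝ), 0 < s → s ≤ c → Box (slice S 0) →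
      WindowRun 𝕊 ε₀ α Kb Ka Eb Et s S → (∀ i k, -Kb ≤ k → k ≤ Ka → ∀ u ∈ Icc 0 s, |S i k u| ≤ M k) →
        ∀ u ∈ Icc 0 s, ∃ j, j < N ∧ Hull j (slice S u) :=
  fun _ _ hs hsc hb hrun hM _ hu =>
    exists_hull_of_mesh ht0 hmono hstep hrun (hbox _ hb) hM hs (hsc.trans hc) hu

/-- **THE CLAUSE `hbefore` OF ONE BRANCH FROM ITS MESH**: start box `Box ⊆ Node 0`, steps `j < j₁` certified,
`sec < lev` on `Node j₁` ⇒ every window run of length `t j₁` from `Box` (a priori in the closed `M`-box) has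
`sec < lev` at time `t j₁` — the hypothesis `hbefore` of `hland_of_branches` with `tlo := t j₁`.
[cite: Tao2016AveragedNS, §6.3–6.4 Props. 6.4–6.5 (statement shape; the readout at the crossing); cell certificate format, branch layer from mesh layer] -/
theorem sec_lt_of_mesh {sec : (Fin m → ℤ → ℝ) → ℝ} {lev : ℝ} {j₁ : ℕ} (ht0 : t 0 = 0)
    (hmono : ∀ j, j < j₁ → t j < t (j + 1)) (hbox : ∀ y, Box y → Node 0 y)
    (hstep : ∀ j, j < j₁ → StepCert 𝕊 ε₀ α Kb Ka Eb Et M t Node Hull j)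
    (hbefore : ∀ y, Node j₁ y → sec y < lev) :
    ∀ S : Fin m → ℤ → ℝ → ℝ, Box (slice S 0) → WindowRun 𝕊 ε₀ α Kb Ka Eb Et (t j₁) S →
      (∀ i k, -Kb ≤ k → k ≤ Ka → ∀ u ∈ Icc 0 (t j₁), |S i k u| ≤ M k) → sec (slice S (t j₁)) < lev :=
  fun _ hb hrun hM => hbefore _ (node_of_mesh ht0 hmono hstep hrun (hbox _ hb) hM j₁ le_rfl le_rfl)

/-- **THE CLAUSE `hafter` OF ONE BRANCH FROM ITS MESH**: start box `Box ⊆ Node 0`, steps `j < j₂'` certified,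
`lev ≤ sec` on `Node j₂'` ⇒ every window run of length `t j₂'` from `Box` (a priori in the closed `M`-box) has
`lev ≤ sec` at time `t j₂'` — the hypothesis `hafter` of `hland_of_branches` with `thi := t j₂'`.
[cite: Tao2016AveragedNS, §6.3–6.4 Props. 6.4–6.5 (statement shape; the readout at the crossing); cell certificate format, branch layer from mesh layer] -/
theorem le_sec_of_mesh {sec : (Fin m → ℤ → ℝ) → ℝ} {lev : ℝ} {j₂' : ℕ} (ht0 : t 0 = 0)
    (hmono : ∀ j, j < j₂' → t j < t (j + 1)) (hbox : ∀ y, Box y → Node 0 y)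
    (hstep : ∀ j, j < j₂' → StepCert 𝕊 ε₀ α Kb Ka Eb Et M t Node Hull j)
    (hafter : ∀ y, Node j₂' y → lev ≤ sec y) :
    ∀ S : Fin m → ℤ → ℝ → ℝ, Box (slice S 0) → WindowRun 𝕊 ε₀ α Kb Ka Eb Et (t j₂') S →
      (∀ i k, -Kb ≤ k → k ≤ Ka → ∀ u ∈ Icc 0 (t j₂'), |S i k u| ≤ M k) → lev ≤ sec (slice S (t j₂')) :=
  fun _ hb hrun hM => hafter _ (node_of_mesh ht0 hmono hstep hrun (hbox _ hb) hM j₂' le_rfl le_rfl)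

/-- **THE CLAUSE `hread` OF ONE BRANCH FROM ITS MESH**: start box `Box ⊆ Node 0`, mesh with `0 < t j₁`, steps
`j ≤ j₂` certified (`j₁ ≤ j₂`), and a static property `P` holding on the node `Node j₁` and on every hull `Hull j`,
`j₁ ≤ j ≤ j₂` ⇒ every window run of length `s ∈ [t j₁, t (j₂+1)]` from `Box` (a priori in the closed `M`-box) ends
in a state satisfying `P` — the hypothesis `hread` of `hland_of_branches` (with `P y := sec y = lev → readout`, vacuous
on `Node j₁` where `sec < lev`) on `[tlo, thi] := [t j₁, t (j₂+1)]`. (At `s = t j₁` exactly only the node is known;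
for `s > t j₁` the state lies in the hull of the step containing `s`.)
[cite: Tao2016AveragedNS, §6.3–6.4 Props. 6.4–6.5 (statement shape; the readout at the crossing); cell certificate format, branch layer from mesh layer] -/
theorem read_of_mesh {P : (Fin m → ℤ → ℝ) → Prop} {j₁ j₂ : ℕ} (hj : j₁ ≤ j₂) (ht0 : t 0 = 0)
    (hmono : ∀ j, j < j₂ + 1 → t j < t (j + 1)) (hpos : 0 < t j₁) (hbox : ∀ y, Box y → Node 0 y)
    (hstep : ∀ j, j < j₂ + 1 → StepCert 𝕊 ε₀ α Kb Ka Eb Et M t Node Hull j)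
    (hP₁ : ∀ y, Node j₁ y → P y) (hP : ∀ j, j₁ ≤ j → j ≤ j₂ → ∀ y, Hull j y → P y) :
    ∀ (s : ℝ) (S : Fin m → ℤ → ℝ → ℝ), t j₁ ≤ s → s ≤ t (j₂ + 1) → Box (slice S 0) →
      WindowRun 𝕊 ε₀ α Kb Ka Eb Et s S → (∀ i k, -Kb ≤ k → k ≤ Ka → ∀ u ∈ Icc 0 s, |S i k u| ≤ M k) →
        P (slice S s) := by
  intro s S hs1 hs2 hb hrun hM
  have hs : 0 < s := hpos.trans_le hs1
  have htmono : ∀ j j', j ≤ j' → j' ≤ j₂ + 1 → t j ≤ t j' := by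
    intro j j' hjj' hj'
    induction j' with
    | zero => rw [Nat.le_zero.mp hjj']
    | succ j' ih =>
      rcases Nat.lt_or_ge j (j' + 1) with h | h
      · exact (ih (by omega) (by omega)).trans (hmono j' (by omega)).le
      · rw [le_antisymm hjj' h]
  rcases hs1.eq_or_lt with hs1' | hs1'
  · -- `s = t j₁`: the state is the node `j₁`
    rw [← hs1']
    rw [← hs1'] at hrun hM
    exact hP₁ _ (node_of_mesh ht0 hmono hstep hrun (hbox _ hb) hM j₁ (by omega) le_rfl)
  -- the step `j ∈ [j₁, j₂]` containing `s > t j₁`: the first index with `s ≤ t (j+1)`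
  classical
  have hex : ∃ j, s ≤ t (j + 1) := ⟨j₂, hs2⟩
  set j := Nat.find hex with hjdef
  have hju : s ≤ t (j + 1) := Nat.find_spec hex
  have hj2 : j ≤ j₂ := Nat.find_min' hex hs2
  have htj : t j < s := by
    rcases Nat.eq_zero_or_pos j with h | h
    · rw [h, ht0]; exact hs
    · have hmin := Nat.find_min hex (show j - 1 < j by omega)
      rw [Nat.sub_add_cancel h] at hmin
      push Not at hmin
      exact hmin
  have hj1 : j₁ ≤ j := by
    by_contra h
    push Not at h
    have : t (j + 1) ≤ t j₁ := htmono (j + 1) j₁ (by omega) (by omega)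
    linarith
  exact hP j hj1 hj2 _ (hull_of_mesh ht0 hmono hstep hrun (hbox _ hb) hM (show j < j₂ + 1 by omega) htj
    htj.le hju le_rfl)

end OneBranch

/-! ### A family of branches: the two clauses of glue IV -/

section Branches

variable {ι : Type*} {Core : (Fin m → ℤ → ℝ) → Prop} {w : ℤ → ℝ} {r : ℝ}
  {Box : ι → (Fin m → ℤ → ℝ) → Prop} {t : ι → ℕ → ℝ} {N : ι → ℕ}
  {Node Hull : ι → ℕ → (Fin m → ℤ → ℝ) → Prop}

/-- **THE TRAPPING CLAUSE `htrap` FROM PER-BRANCH MESH CERTIFICATES**: the fattened core is covered by the start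
boxes `Box b`; per branch a mesh `0 = t b 0 < … < t b (N b)` with `c ≤ t b (N b)`, `Box b ⊆ Node b 0`, every step
certified, and every hull `Hull b j` (`j < N b`) inside the OPEN `M`-box ⇒ the clause `htrap` of glue IV verbatim
(edge bounds `Eb`, `Et`). [cite: Tao2016AveragedNS, §6.3–6.4 Props. 6.4–6.5 (statement shape of a renormalisation certificate); cell certificate format, branch layer from mesh layer] -/
theorem htrap_of_branchMeshes {c : ℝ}
    (hcover : ∀ (z S₀ : Fin m → ℤ → ℝ), Core z →
      (∀ i k, -Kb ≤ k → k ≤ Ka → w k * |S₀ i k - z i k| ≤ r) → ∃ b, Box b S₀)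
    (ht0 : ∀ b, t b 0 = 0) (hmono : ∀ b j, j < N b → t b j < t b (j + 1)) (hc : ∀ b, c ≤ t b (N b))
    (hbox : ∀ b y, Box b y → Node b 0 y)
    (hstep : ∀ b j, j < N b → StepCert 𝕊 ε₀ α Kb Ka Eb Et M (t b) (Node b) (Hull b) j)
    (hhull : ∀ b j, j < N b → ∀ y, Hull b j y → ∀ i k, -Kb ≤ k → k ≤ Ka → |y i k| < M k) :
    ∀ (s : ℝ) (z : Fin m → ℤ → ℝ) (S : Fin m → ℤ → ℝ → ℝ), Core z → 0 < s → s ≤ c →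
      (∀ i k, -Kb ≤ k → k ≤ Ka → w k * |S i k 0 - z i k| ≤ r) →
      (∀ i k, -Kb ≤ k → k ≤ Ka → ∀ u ∈ Icc 0 s,
        HasDerivWithinAt (S i k) (quadTermOn 𝕊 ε₀ α S i k u) (Icc 0 s) u) →
      (∀ i, ContinuousOn (S i (-Kb - 1)) (Icc 0 s)) → (∀ i, ContinuousOn (S i (Ka + 1)) (Icc 0 s)) →
      (∀ i, ∀ u ∈ Icc 0 s, |S i (-Kb - 1) u| ≤ Eb) →
      (∀ i, ∀ u ∈ Icc 0 s, |S i (Ka + 1) u| ≤ Et) →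
      (∀ i k, -Kb ≤ k → k ≤ Ka → ∀ u ∈ Icc 0 s, |S i k u| ≤ M k) →
        ∀ i k, -Kb ≤ k → k ≤ Ka → ∀ u ∈ Icc 0 s, |S i k u| < M k :=
  htrap_of_branches (Hull := fun b y => ∃ j, j < N b ∧ Hull b j y) hcover
    (fun b => henc_of_mesh (ht0 b) (hmono b) (hc b) (hbox b) (hstep b))
    (fun b y hy i k hk1 hk2 => by
      obtain ⟨j, hj, hjy⟩ := hy
      exact hhull b j hj y hjy i k hk1 hk2)

/-- **THE LANDING CLAUSE `hland` FROM PER-BRANCH MESH CERTIFICATES WITH LANDING WINDOWS**: cover of the fattened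
core by the boxes `Box b ⊆ Node b 0`; per branch a mesh `0 = t b 0 < … < t b (j₂ b + 1) ≤ c₀` with steps
`0 … j₂ b` certified and readout indices `j₁ b ≤ j₂ b` with `0 < t b (j₁ b)`; a section functional `sec` continuous
along window runs with `sec < lev` on `Node b (j₁ b)`, `lev ≤ sec` on `Node b (j₂ b + 1)`, and the STATIC READOUT
at every state of every hull `Hull b j`, `j₁ b ≤ j ≤ j₂ b`, on the section `{sec = lev}` ⇒ the clause `hland` of
glue IV verbatim (edge bounds `Eb`, `Et`, exit factor `Zx`). The crossing time is chosen per trajectory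
(intermediate value theorem on `[t b (j₁ b), t b (j₂ b + 1)]`, glue X-c). [cite: Tao2016AveragedNS, §6.3–6.4 Props. 6.4–6.5 (statement shape of a renormalisation certificate; the readout at the crossing); cell certificate format, branch layer from mesh layer] -/
theorem hland_of_branchMeshes {ρ θ₀ σ c₀ Zx : ℝ} {i₀ : Fin m} {sec : (Fin m → ℤ → ℝ) → ℝ} {lev : ℝ}
    {j₁ j₂ : ι → ℕ}
    (hcover : ∀ (z S₀ : Fin m → ℤ → ℝ), Core z →
      (∀ i k, -Kb ≤ k → k ≤ Ka → w k * |S₀ i k - z i k| ≤ r) → ∃ b, Box b S₀)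
    (hj : ∀ b, j₁ b ≤ j₂ b) (ht0 : ∀ b, t b 0 = 0) (hmono : ∀ b j, j < j₂ b + 1 → t b j < t b (j + 1))
    (hpos : ∀ b, 0 < t b (j₁ b)) (hc₀ : ∀ b, t b (j₂ b + 1) ≤ c₀) (hbox : ∀ b y, Box b y → Node b 0 y)
    (hstep : ∀ b j, j < j₂ b + 1 → StepCert 𝕊 ε₀ α Kb Ka Eb Et M (t b) (Node b) (Hull b) j)
    (hsec : ∀ (s : ℝ) (S : Fin m → ℤ → ℝ → ℝ), WindowRun 𝕊 ε₀ α Kb Ka Eb Et s S →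
      ContinuousOn (fun u => sec (slice S u)) (Icc 0 s))
    (hbefore : ∀ b y, Node b (j₁ b) y → sec y < lev) (hafter : ∀ b y, Node b (j₂ b + 1) y → lev ≤ sec y)
    (hread : ∀ b j, j₁ b ≤ j → j ≤ j₂ b → ∀ y, Hull b j y → sec y = lev →
      ∃ (a : ℝ) (z' : Fin m → ℤ → ℝ), 0 < a ∧ (1 + ε₀) ^ (-θ₀) ≤ a ∧ (1 + σ) * a ≤ |y i₀ 1| ∧ Core z' ∧
        (∀ i k, -Kb ≤ k → k + 1 ≤ Ka → w k * |y i (1 + k) / a - z' i k| ≤ ρ * r) ∧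
        (∀ (i : Fin m) (v : ℝ), |v| ≤ Et → w Ka * |v / a - z' i Ka| ≤ ρ * r) ∧
        (∀ i, |y i (-Kb)| ≤ a * Zx)) :
    ∀ (z : Fin m → ℤ → ℝ) (S : Fin m → ℤ → ℝ → ℝ), Core z →
      (∀ i k, -Kb ≤ k → k ≤ Ka → w k * |S i k 0 - z i k| ≤ r) →
      (∀ i k, -Kb ≤ k → k ≤ Ka → ∀ u ∈ Icc 0 c₀,
        HasDerivWithinAt (S i k) (quadTermOn 𝕊 ε₀ α S i k u) (Icc 0 c₀) u) →
      (∀ i, ContinuousOn (S i (-Kb - 1)) (Icc 0 c₀)) → (∀ i, ContinuousOn (S i (Ka + 1)) (Icc 0 c₀)) →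
      (∀ i, ∀ u ∈ Icc 0 c₀, |S i (-Kb - 1) u| ≤ Eb) →
      (∀ i, ∀ u ∈ Icc 0 c₀, |S i (Ka + 1) u| ≤ Et) →
      (∀ i k, -Kb ≤ k → k ≤ Ka → ∀ u ∈ Icc 0 c₀, |S i k u| ≤ M k) →
        ∃ (τ₁ a : ℝ) (z' : Fin m → ℤ → ℝ), 0 < τ₁ ∧ τ₁ ≤ c₀ ∧ 0 < a ∧ (1 + ε₀) ^ (-θ₀) ≤ a ∧
          (1 + σ) * a ≤ |S i₀ 1 τ₁| ∧ Core z' ∧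
          (∀ i k, -Kb ≤ k → k + 1 ≤ Ka → w k * |S i (1 + k) τ₁ / a - z' i k| ≤ ρ * r) ∧
          (∀ (i : Fin m) (v : ℝ), |v| ≤ Et → w Ka * |v / a - z' i Ka| ≤ ρ * r) ∧
          (∀ i, |S i (-Kb) τ₁| ≤ a * Zx) := by
  have htmono : ∀ b j j', j ≤ j' → j' ≤ j₂ b + 1 → t b j ≤ t b j' := by
    intro b j j' hjj' hj'
    induction j' with
    | zero => rw [Nat.le_zero.mp hjj']
    | succ j' ih =>
      rcases Nat.lt_or_ge j (j' + 1) with h | h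
      · exact (ih (by omega) (by omega)).trans (hmono b j' (by omega)).le
      · rw [le_antisymm hjj' h]
  refine hland_of_branches (tlo := fun b => t b (j₁ b)) (thi := fun b => t b (j₂ b + 1)) hcover
    (fun b => ⟨hpos b, htmono b _ _ (by have := hj b; omega) le_rfl, hc₀ b⟩) hsec
    (fun b => sec_lt_of_mesh (ht0 b) (fun j hj' => hmono b j (by have := hj b; omega)) (hbox b)
      (fun j hj' => hstep b j (by have := hj b; omega)) (hbefore b))
    (fun b => le_sec_of_mesh (ht0 b) (hmono b) (hbox b) (hstep b) (hafter b))
    (fun b s S hs1 hs2 hb hrun hM => ?_)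
  exact read_of_mesh (P := fun y => sec y = lev → _) (hj b) (ht0 b) (hmono b) (hpos b) (hbox b) (hstep b)
    (fun y hy hlev => absurd hlev (hbefore b y hy).ne) (fun j hj1' hj2' y hy => hread b j hj1' hj2' y hy)
    s S hs1 hs2 hb hrun hM

end Branches

end CertificateGlueOn

end Summit.NavierStokesRegularity.NavierStokesRegularity.Theorems

end
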